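import Summits.QuantumFields.YangMills.Theorems.BalabanUVNodesN15KingModelFullPropagatorGradRiemannWeighted
import Summits.QuantumFields.YangMills.Theorems.BalabanUVNodesN15KingModelPotentialDressedDecayRate
import Literature.MathematicalPhysics.QuantumFieldTheory.King1986.MinimizerTwoSpacingDeriv

/-!
# N15 (NE2⁺), King-model rung, part 18b: the GRADIENT of the dressed minimiser decays (Theorem 3.3's derivative clause, dressed)

Cell `pub-ymgap-dag-n15-d` (R134 acceleration DAG, node N15 = NE2, strategy s3 KING-MODEL RUNG), part 18b.  King's Theorem 3.3 (3.7) has two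
clauses: the minimiser `ℋ_k` and its lattice gradient `∂^ηℋ_k` both decay exponentially (the tree's `King1986.Torus.minimiser_row_decay` and
`King1986.Torus.dminimiser_row_decay` BY NAME).  Part 11c ∕ 11d proved the first clause for the DRESSED minimiser
`ℋ_w = ℋ − N^{−(d+1)}G·diag(w)·ℋ_w`; this file proves the second:

* §1 ★ `kingHPot_grad_decay` — differentiating the fixed point in the observation point,
  `∂_μℋ_w(x, b) = ∂_μℋ(x, b) − N^{−(d+1)}Σ_y ∂_μG(x, y)·w(y)·ℋ_w(y, b)`, so with the undressed gradient decay `c_D`, the WEIGHTED Riemann mass `C_{DW}`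
  of the gradient of `G` (part 18a) and the dressed decay `c_H` (part 11c), `|∂_μℋ_w(x, b)| ≤ (c_D + C_{DW}·w₀·c_H)·e^{−δ′|B(x) − b|}` — no Neumann step;
* §2 ★★ `dkingHPot_decay_kingU` — along King's run on the King-admissible tori: `∃ w̄ c δ > 0 ∀ e ∀ k ≥ 1 ∀ |w| ≤ w₀ ≤ w̄ ∀ b μ x`,
  `|N·(ℋ_{k,w}(x + e_μ, b) − ℋ_{k,w}(x, b))| ≤ c·e^{−δ|B(x) − b|}` — Theorem 3.3's derivative clause for the DRESSED minimiser, uniformly in the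
  level, the volume and the potential in the window.

HONEST SCOPE.  King's A = 0 scalar model, King-admissible tori `Π ℤ∕(2L^{e+1})`, odd `L ≥ 3`, `a, m² > 0`, scalar potentials (not gauge fields);
count-neutral (`--supports`), not a discharge of N15, nothing in `YMDAG.*` touched.  WHAT IT IS FOR: the `p = 1` (derivative) site entry of the
dressed minimiser — Prop. 3.8 (3.71) line 2 dressed needs in addition the weighted gradient RATE of `G` (successor part, 11b's induction on
n15-e's `fullPropD_peel_pair_abs_le`).

References: C. King, Commun. Math. Phys. 103 (1986) 323–349, (2.13) p.653, Theorem 3.3 (3.7) p.658, Prop. 3.7 (3.64) p.663 (bib key `King1986`).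
-/

noncomputable section
open scoped BigOperators Matrix
open Finset

namespace Summit.QuantumFields.YangMills.BalabanUVNodes.N15.KingModel

open Literature.MathematicalPhysics.QuantumFieldTheory.Balaban1983to89 hiding blockOf
open Literature.MathematicalPhysics.QuantumFieldTheory.Balaban1983to89.B5Prop11Plancherel (Tor fine unitVec)
open Literature.MathematicalPhysics.QuantumFieldTheory.King1986 (aK aK_pos)
open Literature.MathematicalPhysics.QuantumFieldTheory.King1986.Torus
open Summit.QuantumFields.YangMills.BalabanUVNodes.N15KingModelRung (kingH)

variable {d : ℕ}

/-! ## §1 The gradient of the dressed minimiser from the differentiated fixed point -/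

section Grad

variable {L : ℕ} {Nf : ℕ} [NeZero Nf] {U : Fin (d + 1) → ℕ} [∀ μ, NeZero (U μ)] {a m2 : ℝ}

/-- **THE GRADIENT OF THE DRESSED MINIMISER DECAYS**: if `|ℋ_w(y, b)| ≤ c_H·e^{−δ′|B(y) − b|}` (part 11c), `|∂_μℋ(x, b)| ≤ c_D·e^{−δ′|B(x) − b|}`
(Theorem 3.3's derivative clause), the weighted Riemann mass of `∂_μG` at rate `δ′` is `≤ C_{DW}` (part 18a) and `|w| ≤ w₀`, then
`|N·(ℋ_w(x + e_μ, b) − ℋ_w(x, b))| ≤ (c_D + C_{DW}·w₀·c_H)·e^{−δ′|B(x) − b|}` — the fixed point `ℋ_w = ℋ − N^{−(d+1)}G·diag(w)·ℋ_w` differenced in `x`,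
the weight split through the middle block. [cite: King1986, (2.13) p.653, Theorem 3.3 (3.7) p.658] -/
theorem kingHPot_grad_decay {k : ℕ} (hak : 0 ≤ aK a L k) (hm : 0 < m2) {w : Tor (fine Nf U) → ℝ}
    (hB : IsUnit (fineOpPot Nf U (aK a L k) (((Nf : ℕ) : ℝ) ^ 2) m2 w)) (μ : Fin (d + 1)) {cH cD CDW w₀ δ' : ℝ}
    (hcH : 0 ≤ cH) (hδ' : 0 ≤ δ')
    (hHw : ∀ (b : Tor U) (y : Tor (fine Nf U)), |kingHPot L Nf U a m2 k w b y| ≤ cH * Real.exp (-(δ' * tdistT U (blockOf Nf U y) b)))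
    (hDH : ∀ (b : Tor U) (x : Tor (fine Nf U)),
      |((Nf : ℕ) : ℝ) * (kingH L Nf U a m2 k b (x + unitVec (fine Nf U) μ) - kingH L Nf U a m2 k b x)|
        ≤ cD * Real.exp (-(δ' * tdistT U (blockOf Nf U x) b)))
    (hmassDW : ∀ x : Tor (fine Nf U), (((Nf : ℕ) : ℝ) ^ (d + 1))⁻¹ *
      ∑ y, |((Nf : ℕ) : ℝ) * (constrainedProp Nf U (aK a L k) (((Nf : ℕ) : ℝ) ^ 2) m2 (x + unitVec (fine Nf U) μ) y
          - constrainedProp Nf U (aK a L k) (((Nf : ℕ) : ℝ) ^ 2) m2 x y)|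
        * Real.exp (δ' * tdistT U (blockOf Nf U x) (blockOf Nf U y)) ≤ CDW)
    (hw : ∀ y, |w y| ≤ w₀) (b : Tor U) (x : Tor (fine Nf U)) :
    |((Nf : ℕ) : ℝ) * (kingHPot L Nf U a m2 k w b (x + unitVec (fine Nf U) μ) - kingHPot L Nf U a m2 k w b x)|
      ≤ (cD + CDW * w₀ * cH) * Real.exp (-(δ' * tdistT U (blockOf Nf U x) b)) := by
  have hw₀ := nonneg_of_abs_le hw
  have hNpos : (0 : ℝ) < ((Nf : ℕ) : ℝ) ^ (d + 1) := pow_pos (Nat.cast_pos.mpr (Nat.pos_of_ne_zero (NeZero.ne Nf))) _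
  have hν0 : 0 ≤ (((Nf : ℕ) : ℝ) ^ (d + 1))⁻¹ := inv_nonneg.mpr hNpos.le
  have hN0 : 0 ≤ ((Nf : ℕ) : ℝ) := Nat.cast_nonneg _
  have hCDW : 0 ≤ CDW := le_trans (mul_nonneg hν0 (sum_nonneg fun y _ => mul_nonneg (abs_nonneg _) (Real.exp_pos _).le)) (hmassDW x)
  set G := constrainedProp Nf U (aK a L k) (((Nf : ℕ) : ℝ) ^ 2) m2 with hGdef
  set E : ℝ := Real.exp (-(δ' * tdistT U (blockOf Nf U x) b)) with hEdef
  have hE : 0 < E := Real.exp_pos _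
  -- the differenced fixed point
  have hx1 := kingHPot_fixedPoint (L := L) hak hm hB b (x + unitVec (fine Nf U) μ)
  have hx0 := kingHPot_fixedPoint (L := L) hak hm hB b x
  have hdiff : ((Nf : ℕ) : ℝ) * (kingHPot L Nf U a m2 k w b (x + unitVec (fine Nf U) μ) - kingHPot L Nf U a m2 k w b x)
      = ((Nf : ℕ) : ℝ) * (kingH L Nf U a m2 k b (x + unitVec (fine Nf U) μ) - kingH L Nf U a m2 k b x)
        - (((Nf : ℕ) : ℝ) ^ (d + 1))⁻¹ * ∑ y, ((Nf : ℕ) : ℝ) * (G (x + unitVec (fine Nf U) μ) y - G x y) * w y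
            * kingHPot L Nf U a m2 k w b y := by
    rw [hx1, hx0]
    have e1 : ∀ (S1 S0 H1 H0 ν : ℝ), ((Nf : ℕ) : ℝ) * ((H1 - ν * S1) - (H0 - ν * S0))
        = (Nf : ℝ) * (H1 - H0) - (((Nf : ℕ) : ℝ) * ν * S1 - ((Nf : ℕ) : ℝ) * ν * S0) := by
      intros; ring
    rw [e1, ← mul_sub, ← sum_sub_distrib, mul_sum, mul_sum]
    congr 1
    exact sum_congr rfl fun y _ => by ring
  -- the weight split through the middle block: `e^{−δ′|By − b|} ≤ e^{δ′|Bx − By|}·e^{−δ′|Bx − b|}`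
  have hsplit : ∀ y : Tor (fine Nf U), Real.exp (-(δ' * tdistT U (blockOf Nf U y) b))
      ≤ Real.exp (δ' * tdistT U (blockOf Nf U x) (blockOf Nf U y)) * E := fun y => by
    rw [hEdef, ← Real.exp_add]
    exact Real.exp_le_exp.mpr (by nlinarith [(tdistT_isPseudoDist U).triangle (blockOf Nf U x) (blockOf Nf U y) b])
  rw [hdiff]
  refine (abs_sub _ _).trans ?_
  have hsum : |(((Nf : ℕ) : ℝ) ^ (d + 1))⁻¹ * ∑ y, ((Nf : ℕ) : ℝ) * (G (x + unitVec (fine Nf U) μ) y - G x y) * w y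
        * kingHPot L Nf U a m2 k w b y|
      ≤ CDW * w₀ * cH * E := by
    rw [abs_mul, abs_of_nonneg hν0]
    calc (((Nf : ℕ) : ℝ) ^ (d + 1))⁻¹ * |∑ y, ((Nf : ℕ) : ℝ) * (G (x + unitVec (fine Nf U) μ) y - G x y) * w y
            * kingHPot L Nf U a m2 k w b y|
        ≤ (((Nf : ℕ) : ℝ) ^ (d + 1))⁻¹ * ∑ y, |((Nf : ℕ) : ℝ) * (G (x + unitVec (fine Nf U) μ) y - G x y)|
            * Real.exp (δ' * tdistT U (blockOf Nf U x) (blockOf Nf U y)) * (w₀ * cH * E) := by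
          refine mul_le_mul_of_nonneg_left ((abs_sum_le_sum_abs _ _).trans (sum_le_sum fun y _ => ?_)) hν0
          rw [abs_mul, abs_mul]
          have h1 : |w y| * |kingHPot L Nf U a m2 k w b y| ≤ w₀ * (cH * Real.exp (-(δ' * tdistT U (blockOf Nf U y) b))) :=
            mul_le_mul (hw y) (hHw b y) (abs_nonneg _) hw₀
          have h2 : w₀ * (cH * Real.exp (-(δ' * tdistT U (blockOf Nf U y) b)))
              ≤ w₀ * (cH * (Real.exp (δ' * tdistT U (blockOf Nf U x) (blockOf Nf U y)) * E)) :=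
            mul_le_mul_of_nonneg_left (mul_le_mul_of_nonneg_left (hsplit y) hcH) hw₀
          calc |((Nf : ℕ) : ℝ) * (G (x + unitVec (fine Nf U) μ) y - G x y)| * |w y| * |kingHPot L Nf U a m2 k w b y|
              = |((Nf : ℕ) : ℝ) * (G (x + unitVec (fine Nf U) μ) y - G x y)| * (|w y| * |kingHPot L Nf U a m2 k w b y|) := by ring
            _ ≤ |((Nf : ℕ) : ℝ) * (G (x + unitVec (fine Nf U) μ) y - G x y)|
                * (w₀ * (cH * (Real.exp (δ' * tdistT U (blockOf Nf U x) (blockOf Nf U y)) * E))) :=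
                mul_le_mul_of_nonneg_left (h1.trans h2) (abs_nonneg _)
            _ = _ := by ring
      _ = ((((Nf : ℕ) : ℝ) ^ (d + 1))⁻¹ * ∑ y, |((Nf : ℕ) : ℝ) * (G (x + unitVec (fine Nf U) μ) y - G x y)|
            * Real.exp (δ' * tdistT U (blockOf Nf U x) (blockOf Nf U y))) * (w₀ * cH * E) := by
          rw [← sum_mul]; ring
      _ ≤ CDW * (w₀ * cH * E) := mul_le_mul_of_nonneg_right (hmassDW x) (by positivity)
      _ = CDW * w₀ * cH * E := by ring
  calc |((Nf : ℕ) : ℝ) * (kingH L Nf U a m2 k b (x + unitVec (fine Nf U) μ) - kingH L Nf U a m2 k b x)|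
        + |(((Nf : ℕ) : ℝ) ^ (d + 1))⁻¹ * ∑ y, ((Nf : ℕ) : ℝ) * (G (x + unitVec (fine Nf U) μ) y - G x y) * w y
            * kingHPot L Nf U a m2 k w b y|
      ≤ cD * E + CDW * w₀ * cH * E := add_le_add (hDH b x) hsum
    _ = (cD + CDW * w₀ * cH) * E := by ring

end Grad

/-! ## §2 Along King's run: Theorem 3.3's derivative clause for the dressed minimiser -/

section Run

open Real

variable (L : ℕ) [NeZero L]

/-- **THE UNIFORM DECAY OF THE GRADIENT OF KING'S MINIMISER ON THE KING-ADMISSIBLE TORI** (the tree's `dminimiser_row_decay` BY NAME):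
`∃ δ c > 0` with `|N·(ℋ_k(x + e_μ, b) − ℋ_k(x, b))| ≤ c·e^{−δ′|B(x) − b|}` for every `0 < δ′ ≤ δ`, volume exponent, `k ≥ 1`, spelling `N = L^k`,
block, direction and fine point. [cite: King1986, Theorem 3.3 (3.7) p.658, Prop. 3.7 (3.64) p.663] -/
theorem dkingH_decay_kingU (hLodd : Odd L) (hL : 2 ≤ L) {a m2 : ℝ} (ha : 0 < a) (hm : 0 ≤ m2) :
    ∃ δ c : ℝ, 0 < δ ∧ 0 < c ∧ ∀ (δ' : ℝ), 0 < δ' → δ' ≤ δ → ∀ (e k : ℕ), 1 ≤ k → ∀ (N : ℕ) [NeZero N], N = L ^ k →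
      ∀ (b : Tor (kingU d L e)) (μ : Fin (d + 1)) (x : Tor (fine N (kingU d L e))),
        |((N : ℕ) : ℝ) * (kingH L N (kingU d L e) a m2 k b (x + unitVec (fine N (kingU d L e)) μ) - kingH L N (kingU d L e) a m2 k b x)|
          ≤ c * Real.exp (-(δ' * tdistT (kingU d L e) (blockOf N (kingU d L e) x) b)) := by
  have hL1 : 1 < L := by omega
  obtain ⟨δ₀, c₀, hδ₀, hc₀, H⟩ := dminimiser_row_decay (d + 1) L (Nat.succ_pos d) ⟨hLodd, hL1⟩ ha hm
  refine ⟨δ₀, a * c₀, hδ₀, mul_pos ha hc₀, fun δ' hδ'0 hδ'1 e k hk N _ hN b μ x => ?_⟩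
  exact H ⟨d + 1, L, e + 1, k, Nat.succ_pos d, hLodd, hL1⟩ rfl rfl hk (kingU d L e) (kingU_eq_sitesPerDir L hLodd hL e k) N hN
    δ' hδ'0 hδ'1 x b μ

/-- **THEOREM 3.3's DERIVATIVE CLAUSE FOR THE DRESSED MINIMISER, ALONG KING'S RUN.**  For odd `L ≥ 3`, `a, m² > 0` there are `w̄, c, δ > 0`
such that for every volume exponent `e`, every `k ≥ 1` (any spelling `N = L^k`), every potential `w` on the fine torus with `sup|w| ≤ w₀ ≤ w̄`, every
block `b`, direction `μ` and fine point `x`:  `|N·(ℋ_{k,w}(x + e_μ, b) − ℋ_{k,w}(x, b))| ≤ c·e^{−δ|B(x) − b|}` — §1 on part 11d's dressed decay,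
`dkingH_decay_kingU` and part 18a's weighted gradient mass, in part 9c's window. [cite: King1986, Theorem 3.3 (3.7) p.658 (derivative clause, A = 0 model)] -/
theorem dkingHPot_decay_kingU (hLodd : Odd L) (hL : 2 ≤ L) {a m2 : ℝ} (ha : 0 < a) (hm : 0 < m2) :
    ∃ wb c δ : ℝ, 0 < wb ∧ 0 < c ∧ 0 < δ ∧ ∀ (e k : ℕ), 1 ≤ k → ∀ (N : ℕ) [NeZero N], N = L ^ k →
      ∀ (w : Tor (fine N (kingU d L e)) → ℝ) (w₀ : ℝ), (∀ y, |w y| ≤ w₀) → w₀ ≤ wb →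
      ∀ (b : Tor (kingU d L e)) (μ : Fin (d + 1)) (x : Tor (fine N (kingU d L e))),
        |((N : ℕ) : ℝ) * (kingHPot L N (kingU d L e) a m2 k w b (x + unitVec (fine N (kingU d L e)) μ)
            - kingHPot L N (kingU d L e) a m2 k w b x)|
          ≤ c * Real.exp (-(δ * tdistT (kingU d L e) (blockOf N (kingU d L e) x) b)) := by
  have hL1 : 1 < L := by omega
  have hLr : (1 : ℝ) < L := by exact_mod_cast hL1
  obtain ⟨wbP, cP, δP, hwbP, hcP, hδP, HP⟩ := kingHPot_decay_kingU (d := d) L hLodd hL ha hm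
  obtain ⟨δD, cD, hδD, hcD, HD⟩ := dkingH_decay_kingU (d := d) L hLodd hL ha hm.le
  obtain ⟨δW, CW, hδW, hCW, HW⟩ := fullPropD_riemannMassW_unif (d := d) L hLodd hL ha hm.le
  obtain ⟨-, -, hwbar⟩ := dressedConsts_nonneg (d := d) ha hL
  set δ : ℝ := min δP (min δD δW) with hδdef
  have hδ : 0 < δ := lt_min hδP (lt_min hδD hδW)
  have hδP' : δ ≤ δP := min_le_left _ _
  have hδD' : δ ≤ δD := (min_le_right _ _).trans (min_le_left _ _)
  have hδW' : δ ≤ δW := (min_le_right _ _).trans (min_le_right _ _)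
  set wb : ℝ := min wbP (wbarK (d + 1) a L) with hwbdef
  have hwb : 0 < wb := lt_min hwbP hwbar
  refine ⟨wb, cD + CW * wb * cP, δ, hwb, by positivity, hδ, fun e k hk N _ hN w w₀ hw hwle b μ x => ?_⟩
  subst hN
  have hM' : ∀ μ, kingU d L e μ = 2 * L ^ (e + 1) := fun μ => by
    show L * (2 * L ^ e) = 2 * L ^ (e + 1)
    ring
  have hak : 0 < aK a L k := aK_pos ha hLr hk
  have hw₀ : 0 ≤ w₀ := (abs_nonneg _).trans (hw fun _ => 0)
  have hlo : ∀ y, -w₀ ≤ w y := fun y => (abs_le.mp (hw y)).1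
  have hB : IsUnit (fineOpPot (L ^ k) (kingU d L e) (aK a L k) (((L ^ k : ℕ) : ℝ) ^ 2) m2 w) :=
    fineOpPot_isUnit hak.le hm.le hlo (by
      obtain ⟨-, -, hgap, -⟩ := gap_unif (d := d) ha hL hk (hwle.trans (min_le_right _ _))
      have hP : 0 ≤ (2 * ((d + 1 : ℕ) : ℝ) + aK a L k) * (4 * kapCT (d + 1) a L) ^ 2 := by positivity
      linarith)
  have hHw : ∀ (b : Tor (kingU d L e)) (y : Tor (fine (L ^ k) (kingU d L e))),
      |kingHPot L (L ^ k) (kingU d L e) a m2 k w b y| ≤ cP * Real.exp (-(δ * tdistT (kingU d L e) (blockOf (L ^ k) (kingU d L e) y) b)) :=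
    fun b y => decay_mono hcP.le hδP' ((tdistT_isPseudoDist (kingU d L e)).nonneg _ _)
      (HP e k hk (L ^ k) rfl w w₀ hw (hwle.trans (min_le_left _ _)) b y)
  have hDH : ∀ (b : Tor (kingU d L e)) (y : Tor (fine (L ^ k) (kingU d L e))),
      |((L ^ k : ℕ) : ℝ) * (kingH L (L ^ k) (kingU d L e) a m2 k b (y + unitVec (fine (L ^ k) (kingU d L e)) μ)
          - kingH L (L ^ k) (kingU d L e) a m2 k b y)|
        ≤ cD * Real.exp (-(δ * tdistT (kingU d L e) (blockOf (L ^ k) (kingU d L e) y) b)) :=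
    fun b y => HD δ hδ hδD' e k hk (L ^ k) rfl b μ y
  have hmassDW : ∀ y : Tor (fine (L ^ k) (kingU d L e)), (((L ^ k : ℕ) : ℝ) ^ (d + 1))⁻¹ *
      ∑ y', |((L ^ k : ℕ) : ℝ) * (constrainedProp (L ^ k) (kingU d L e) (aK a L k) (((L ^ k : ℕ) : ℝ) ^ 2) m2
          (y + unitVec (fine (L ^ k) (kingU d L e)) μ) y'
          - constrainedProp (L ^ k) (kingU d L e) (aK a L k) (((L ^ k : ℕ) : ℝ) ^ 2) m2 y y')|
        * Real.exp (δ * tdistT (kingU d L e) (blockOf (L ^ k) (kingU d L e) y) (blockOf (L ^ k) (kingU d L e) y')) ≤ CW :=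
    fun y => HW k hk δ hδ.le hδW' (L ^ k) rfl (e + 1) (kingU d L e) hM' m2 hm le_rfl μ y
  have h := kingHPot_grad_decay hak.le hm hB μ hcP.le hδ.le hHw hDH hmassDW hw b x
  refine h.trans (mul_le_mul_of_nonneg_right ?_ (Real.exp_pos _).le)
  have : CW * w₀ * cP ≤ CW * wb * cP := by gcongr
  linarith

end Run

end Summit.QuantumFields.YangMills.BalabanUVNodes.N15.KingModel
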